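import Summits.CriticalPhenomena.PercolationContinuityZ3.Theorems.PercNearOneGluingNoHeavyLowerTailSahiC3CubeFourFKGOrbit5A
import Mathlib.Tactic.Linarith
import Mathlib.Tactic.Ring
import HarnessLib
import HarnessLib.Audit

/-!
# `NoHeavyLowerTail` (crux stmt-CriticalPhenomena-4575), Sahi programme P4: data-encoded Ahlswede–Daykin certificates on the `4`-cube

Support file (cell `prim-l12`, seat P4; `--supports stmt-CriticalPhenomena-4575`).  No named facts, no sorries; standard axioms.

Ten of the eleven residual `S₄`-orbits of tri-saturated triples of `{0,1}⁴` (HOME prim-l12-p4/FINDING-gen4-FKG-CUBE4-C3.md) carry LP certificates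
`d · Z³E₃ = Σ c·μ(pᵢ)μ(pⱼ)μ(pₖ) + Σ c·μ(p_z)·[m(M)·m(J) − m(F)·m(G)]` with natural-number coefficients, where `(F, G, M, J)` are explicit sets of
cube points with every meet of `F × G` in `M` and every join in `J`, so that each bracket is nonnegative by the four functions theorem
(`SahiC3CubeFourFKG.ad_massL`).  This file provides the two evaluators `evalMon4`, `evalAD4` (data = lists of naturals / code lists), their
nonnegativity (`evalMon4_nonneg`; `evalAD4_nonneg` under the decidable closure condition `ADValid`, checked by `decide` on the data), and the
mass-by-code lemmas `mass4_of_code`, `mass4_univ`; the certificate files `…SahiC3CubeFourFKGHard*` then verify each identity by `ring`.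
-/

namespace Summit.CriticalPhenomena.PercolationContinuityZ3.Theorems.SahiC3CubeFourFKG

open Finset Literature.Probability.LatticeModels SahiC3Cube

variable {μ : (Fin 4 → Bool) → ℝ}

/-- Total mass of the `4`-cube as a code-list mass. [this work] -/
theorem mass4_univ : mass μ (univ : Finset (Fin 4 → Bool)) = massL 4 μ [0, 1, 2, 3, 4, 5, 6, 7, 8, 9, 10, 11, 12, 13, 14, 15] := by
  rw [mass_eq_massL, encF_univ]; rfl

/-- Mass of a coded set of the `4`-cube. [this work] -/
theorem mass4_of_code {A : Finset (Fin 4 → Bool)} {a : ℕ} (h : encF 4 A = a) : mass μ A = massL 4 μ (bitsL 16 a) := by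
  rw [mass_eq_massL, h]; rfl

/-- Nonnegative cubic monomials from data: `Σ c · μ(pᵢ)μ(pⱼ)μ(pₖ)`, `c : ℕ`. [this work] -/
def evalMon4 (μ : (Fin 4 → Bool) → ℝ) (L : List (ℕ × ℕ × ℕ × ℕ)) : ℝ :=
  (L.map fun e => (e.1 : ℝ) * (μ (ptB 4 e.2.1) * μ (ptB 4 e.2.2.1) * μ (ptB 4 e.2.2.2))).sum

/-- Weighted Ahlswede–Daykin brackets from data: entries `(c, z, F, G, M, J)` (point code `z`, code LISTS `F, G, M, J`) contribute
`c · μ(p_z) · (m(M)·m(J) − m(F)·m(G))`. [this work] -/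
def evalAD4 (μ : (Fin 4 → Bool) → ℝ) (L : List (ℕ × ℕ × List ℕ × List ℕ × List ℕ × List ℕ)) : ℝ :=
  (L.map fun e => (e.1 : ℝ) * μ (ptB 4 e.2.1) *
    (massL 4 μ e.2.2.2.2.1 * massL 4 μ e.2.2.2.2.2 - massL 4 μ e.2.2.1 * massL 4 μ e.2.2.2.1)).sum

/-- The closure condition making an entry of `evalAD4` an instance of the four functions theorem: duplicate-free code lists below `16`, every
meet of `F × G` in `M` and every join in `J`. [this work] -/
def ADValid (e : ℕ × ℕ × List ℕ × List ℕ × List ℕ × List ℕ) : Prop :=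
  e.2.2.1.Nodup ∧ e.2.2.2.1.Nodup ∧ e.2.2.2.2.1.Nodup ∧ e.2.2.2.2.2.Nodup ∧
  (∀ i ∈ e.2.2.1, i < 2 ^ 4) ∧ (∀ i ∈ e.2.2.2.1, i < 2 ^ 4) ∧ (∀ i ∈ e.2.2.2.2.1, i < 2 ^ 4) ∧ (∀ i ∈ e.2.2.2.2.2, i < 2 ^ 4) ∧
  (∀ i ∈ e.2.2.1, ∀ j ∈ e.2.2.2.1, (i &&& j) ∈ e.2.2.2.2.1 ∧ (i ||| j) ∈ e.2.2.2.2.2)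

/-- `ADValid` is decidable (a finite check on the data). [this work] -/
instance (e : ℕ × ℕ × List ℕ × List ℕ × List ℕ × List ℕ) : Decidable (ADValid e) := by
  unfold ADValid; infer_instance

/-- `evalMon4 μ L ≥ 0` for a nonnegative weight. [this work] -/
theorem evalMon4_nonneg (hμ₀ : 0 ≤ μ) (L : List (ℕ × ℕ × ℕ × ℕ)) : 0 ≤ evalMon4 μ L := by
  unfold evalMon4
  induction L with
  | nil => simp
  | cons e L ih =>
    rw [List.map_cons, List.sum_cons]
    exact add_nonneg (mul_nonneg (by positivity) (mul_nonneg (mul_nonneg (hμ₀ _) (hμ₀ _)) (hμ₀ _))) ih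

/-- `evalAD4 μ L ≥ 0` for a nonnegative log-supermodular weight when every entry satisfies `ADValid` (four functions theorem, entrywise).
[this work] -/
theorem evalAD4_nonneg (hμ₀ : 0 ≤ μ) (hμ : ∀ a b, μ a * μ b ≤ μ (a ⊓ b) * μ (a ⊔ b))
    (L : List (ℕ × ℕ × List ℕ × List ℕ × List ℕ × List ℕ)) (hL : ∀ e ∈ L, ADValid e) : 0 ≤ evalAD4 μ L := by
  unfold evalAD4
  induction L with
  | nil => simp
  | cons e L ih =>
    rw [List.map_cons, List.sum_cons]
    obtain ⟨h1, h2, h3, h4, h5, h6, h7, h8, h9⟩ := hL e List.mem_cons_self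
    have had := ad_massL hμ₀ hμ _ _ _ _ h1 h2 h3 h4 h5 h6 h7 h8 h9
    exact add_nonneg (mul_nonneg (mul_nonneg (by positivity) (hμ₀ _)) (sub_nonneg.2 had))
      (ih fun e' he' => hL e' (List.mem_cons_of_mem _ he'))

end Summit.CriticalPhenomena.PercolationContinuityZ3.Theorems.SahiC3CubeFourFKG
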